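import Summits.CriticalPhenomena.PercolationContinuityZ3.Theorems.PercNearOneGluingNoHeavyLowerTailKNGoodR3CaseLow
import HarnessLib

/-!
# `NoHeavyLowerTail` (stmt-CriticalPhenomena-4575) — universal goodness at `|A| = 3`: the real algebra of the
# reduction R3, case "top" (`KNGoodR3.case_top`)

Support file (`--supports stmt-CriticalPhenomena-4575`, hull-port prover `prim-hp-2`, gen 21).  No definitions, no named
facts, no sorries; pure real arithmetic.  Companion of `…KNGoodR3CaseLow.lean` (setting and notation there).  Inputs of the
case lemma: three two-world inequalities (pocket-augmented BHK, tree `KNGoodPocketBHK.core2`), the two loneliness rows of the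
designated relay, `α, β, δ ≥ 0`; null worlds handled by the vanishing of their cells.
[cite: KozmaNitzan2024, §3.2 (p. 12), proof of Thm. 3 (pp. 10–12)]
-/

namespace Summit.CriticalPhenomena.PercolationContinuityZ3.Theorems

namespace KNGoodR3

open Finset

variable {ι : Type*} [Fintype ι]

section CaseTop

variable [DecidableEq ι]

/-- **CASE c = the `T`-top relay** (relays labelled `1 ≤_T 2 ≤_T 3`, relay `3` is the loneliest of `G`).
The goodness slack `−(α+β) m(d,1) − β m(d,2) + ε m(12,12) − γ m(13,2) − δ m(23,1) − Σ_i max(0, L_{i,1}, L_{i,2})`,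
`L_{i,1} = (α+β) p_d − ε p₁₂ + δ p₂₃`, `L_{i,2} = β p_d − ε p₁₂ + γ p₁₃`, is `≥ 0`.
[cite: KozmaNitzan2024, §3.2 (p. 12), proof of Thm. 3 (pp. 10–12)] -/
theorem case_top (α β γ δ ε Qd Q12 Q13 Q23 md1 md2 m12_12 m13_2 m23_1 : ℝ) (pd p12 p13 p23 : ι → ℝ)
    (hα : 0 ≤ α) (hβ : 0 ≤ β) (hδ : 0 ≤ δ)
    (hQd : 0 ≤ Qd) (hQ12 : 0 ≤ Q12) (hQ13 : 0 ≤ Q13) (hQ23 : 0 ≤ Q23)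
    (hmd1 : 0 ≤ md1) (hmd2 : 0 ≤ md2) (hm12_12 : 0 ≤ m12_12) (hm13_2 : 0 ≤ m13_2) (hm23_1 : 0 ≤ m23_1)
    (hpd : ∀ i, 0 ≤ pd i) (hp12 : ∀ i, 0 ≤ p12 i) (hp13 : ∀ i, 0 ≤ p13 i) (hp23 : ∀ i, 0 ≤ p23 i)
    (hTd : ∀ 𝒬 : Finset ι, md1 + md2 + ∑ i ∈ 𝒬, pd i ≤ Qd)
    (hT12 : ∀ 𝒬 : Finset ι, m12_12 + ∑ i ∈ 𝒬, p12 i ≤ Q12)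
    (hT13 : ∀ 𝒬 : Finset ι, m13_2 + ∑ i ∈ 𝒬, p13 i ≤ Q13)
    (hT23 : ∀ 𝒬 : Finset ι, m23_1 + ∑ i ∈ 𝒬, p23 i ≤ Q23)
    (hdeg : Qd = 0 → (Q12 = 0 ∧ Q13 = 0) ∨ (Q12 = 0 ∧ Q23 = 0) ∨ (Q13 = 0 ∧ Q23 = 0))
    (hI12b : ∀ 𝒬 : Finset ι, Q12 * (md1 + md2 + ∑ i ∈ 𝒬, pd i) ≤ Qd * (m12_12 + ∑ i ∈ 𝒬, p12 i))
    (hI13a : ∀ 𝒬 : Finset ι, Qd * (m13_2 + ∑ i ∈ 𝒬, p13 i) ≤ Q13 * (md2 + ∑ i ∈ 𝒬, pd i))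
    (hI23a : ∀ 𝒬 : Finset ι, Qd * (m23_1 + ∑ i ∈ 𝒬, p23 i) ≤ Q23 * (md1 + ∑ i ∈ 𝒬, pd i))
    -- the loneliness rows of relay 3
    (H1 : Qd * (α + β) + Q23 * δ ≤ Q12 * ε) (H2 : Qd * β + Q13 * γ ≤ Q12 * ε) :
    0 ≤ -(α + β) * md1 - β * md2 + ε * m12_12 - γ * m13_2 - δ * m23_1 -
      ∑ i, max 0 (max ((α + β) * pd i - ε * p12 i + δ * p23 i) (β * pd i - ε * p12 i + γ * p13 i)) := by
  set L1 : ι → ℝ := fun i => (α + β) * pd i - ε * p12 i + δ * p23 i with hL1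
  set L2 : ι → ℝ := fun i => β * pd i - ε * p12 i + γ * p13 i with hL2
  set Q1 := univ.filter (fun i => 0 ≤ L1 i ∧ L2 i ≤ L1 i) with hQ1
  set Q2 := univ.filter (fun i => 0 ≤ L2 i ∧ L1 i < L2 i) with hQ2
  have hsplit : ∑ i, max 0 (max (L1 i) (L2 i)) = ∑ i ∈ Q1, L1 i + ∑ i ∈ Q2, L2 i := sum_max_split L1 L2
  have hdis : Disjoint Q1 Q2 := disjoint_split L1 L2
  have e1 : ∑ i ∈ Q1, L1 i = (α + β) * (∑ i ∈ Q1, pd i) - ε * (∑ i ∈ Q1, p12 i) + δ * (∑ i ∈ Q1, p23 i) := by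
    simp only [hL1, Finset.sum_add_distrib, Finset.sum_sub_distrib, ← Finset.mul_sum]
  have e2 : ∑ i ∈ Q2, L2 i = β * (∑ i ∈ Q2, pd i) - ε * (∑ i ∈ Q2, p12 i) + γ * (∑ i ∈ Q2, p13 i) := by
    simp only [hL2, Finset.sum_add_distrib, Finset.sum_sub_distrib, ← Finset.mul_sum]
  show 0 ≤ -(α + β) * md1 - β * md2 + ε * m12_12 - γ * m13_2 - δ * m23_1 - ∑ i, max 0 (max (L1 i) (L2 i))
  rw [hsplit, e1, e2]
  have b12 : Q12 * (md1 + md2 + (∑ i ∈ Q1, pd i + ∑ i ∈ Q2, pd i)) ≤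
      Qd * (m12_12 + (∑ i ∈ Q1, p12 i + ∑ i ∈ Q2, p12 i)) := by
    have := hI12b (Q1 ∪ Q2)
    rwa [Finset.sum_union hdis, Finset.sum_union hdis] at this
  have a13 := hI13a Q2
  have a23 := hI23a Q1
  have t12 : m12_12 + (∑ i ∈ Q1, p12 i + ∑ i ∈ Q2, p12 i) ≤ Q12 := by
    have := hT12 (Q1 ∪ Q2); rwa [Finset.sum_union hdis] at this
  have t13 := hT13 Q2
  have t23 := hT23 Q1
  have td : md1 + md2 + (∑ i ∈ Q1, pd i + ∑ i ∈ Q2, pd i) ≤ Qd := by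
    have := hTd (Q1 ∪ Q2); rwa [Finset.sum_union hdis] at this
  set Pd1 := ∑ i ∈ Q1, pd i with hPd1
  set Pd2 := ∑ i ∈ Q2, pd i with hPd2
  set P12_1 := ∑ i ∈ Q1, p12 i with hP12_1
  set P12_2 := ∑ i ∈ Q2, p12 i with hP12_2
  set P13 := ∑ i ∈ Q2, p13 i with hP13
  set P23 := ∑ i ∈ Q1, p23 i with hP23
  have nPd1 : 0 ≤ Pd1 := Finset.sum_nonneg fun i _ => hpd i
  have nPd2 : 0 ≤ Pd2 := Finset.sum_nonneg fun i _ => hpd i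
  have nP12_1 : 0 ≤ P12_1 := Finset.sum_nonneg fun i _ => hp12 i
  have nP12_2 : 0 ≤ P12_2 := Finset.sum_nonneg fun i _ => hp12 i
  have nP13 : 0 ≤ P13 := Finset.sum_nonneg fun i _ => hp13 i
  have nP23 : 0 ≤ P23 := Finset.sum_nonneg fun i _ => hp23 i
  have goal_eq : -(α + β) * md1 - β * md2 + ε * m12_12 - γ * m13_2 - δ * m23_1 -
      ((α + β) * Pd1 - ε * P12_1 + δ * P23 + (β * Pd2 - ε * P12_2 + γ * P13)) =
      -(α + β) * (md1 + Pd1) - β * (md2 + Pd2) + ε * (m12_12 + (P12_1 + P12_2)) - γ * (m13_2 + P13) -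
        δ * (m23_1 + P23) := by
    ring
  rw [goal_eq]
  set A1 := md1 + Pd1 with hA1
  set A2 := md2 + Pd2 with hA2
  set E := m12_12 + (P12_1 + P12_2) with hE
  set M13 := m13_2 + P13 with hM13
  set D1 := m23_1 + P23 with hD1
  have nA1 : 0 ≤ A1 := add_nonneg hmd1 nPd1
  have nA2 : 0 ≤ A2 := add_nonneg hmd2 nPd2
  have nE : 0 ≤ E := add_nonneg hm12_12 (add_nonneg nP12_1 nP12_2)
  have nM13 : 0 ≤ M13 := add_nonneg hm13_2 nP13
  have nD1 : 0 ≤ D1 := add_nonneg hm23_1 nP23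
  have b12' : Q12 * (A1 + A2) ≤ Qd * E := by rw [hA1, hA2, hE]; linarith [b12]
  have td' : A1 + A2 ≤ Qd := by rw [hA1, hA2]; linarith [td]
  -- `X' = −(α+β) A1 − β A2 + ε E − δ D1 ≥ 0` (the slack without the `γ`-term)
  have hX' : 0 ≤ -(α + β) * A1 - β * A2 + ε * E - δ * D1 := by
    rcases hQd.eq_or_lt with hQd0 | hQdpos
    · have zA1 : A1 = 0 := by linarith
      have zA2 : A2 = 0 := by linarith
      rcases hdeg hQd0.symm with ⟨h12, h13⟩ | ⟨h12, h23⟩ | ⟨h13, h23⟩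
      · have zE : E = 0 := by linarith
        rw [zA1, zA2, zE]
        rcases hQ23.eq_or_lt with hQ230 | hQ23pos
        · have zD1 : D1 = 0 := by linarith
          rw [zD1]; simp
        · have hQδ : Q23 * δ ≤ 0 := by rw [← hQd0, h12] at H1; linarith
          have hδ0 : δ = 0 := le_antisymm (by
            by_contra h; exact absurd hQδ (not_le.2 (mul_pos hQ23pos (lt_of_not_ge h)))) hδ
          rw [hδ0]; simp
      · have zE : E = 0 := by linarith
        have zD1 : D1 = 0 := by linarith
        rw [zA1, zA2, zE, zD1]; simp
      · have zD1 : D1 = 0 := by linarith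
        rw [zA1, zA2, zD1]
        rcases hQ12.eq_or_lt with hQ120 | hQ12pos
        · have zE : E = 0 := by linarith
          rw [zE]; simp
        · have hQε : 0 ≤ Q12 * ε := by rw [← hQd0, h23] at H1; linarith
          have hε : 0 ≤ ε := by
            by_contra h; exact absurd hQε (not_le.2 (mul_neg_of_pos_of_neg hQ12pos (lt_of_not_ge h)))
          have g1 := mul_nonneg hε nE
          linarith
    · rcases hQ12.eq_or_lt with hQ120 | hQ12pos
      · -- `[12]` null: `E = 0`, the row forces `α = β = 0` and `Q23 δ = 0`
        have zE : E = 0 := by linarith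
        have h0 : Qd * (α + β) + Q23 * δ ≤ 0 := by rw [← hQ120] at H1; linarith
        have hab : α + β = 0 := by
          have : Qd * (α + β) ≤ 0 := by linarith [mul_nonneg hQ23 hδ]
          exact le_antisymm (by by_contra h; exact absurd this (not_le.2 (mul_pos hQdpos (lt_of_not_ge h))))
            (add_nonneg hα hβ)
        have hα0 : α = 0 := by linarith
        have hβ0 : β = 0 := by linarith
        have hQδ : Q23 * δ = 0 := le_antisymm (by linarith [mul_nonneg hQd (add_nonneg hα hβ)]) (mul_nonneg hQ23 hδ)
        have hD : δ * D1 ≤ 0 := by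
          have h1 : δ * (Qd * D1) ≤ δ * (Q23 * A1) := mul_le_mul_of_nonneg_left a23 hδ
          have h2 : δ * (Q23 * A1) = 0 := by rw [← mul_assoc, mul_comm δ Q23, hQδ, zero_mul]
          have h4 : Qd * (δ * D1) ≤ 0 := by ring_nf at h1 h2 ⊢; linarith
          have := nonneg_of_mul_pos hQdpos (by linarith : 0 ≤ Qd * (-(δ * D1)))
          linarith
        rw [zE, hα0, hβ0]
        ring_nf at hD ⊢
        linarith
      · refine nonneg_of_mul_pos hQ12pos ?_
        have h1 : E * (Qd * (α + β) + Q23 * δ) ≤ E * (Q12 * ε) := mul_le_mul_of_nonneg_left H1 nE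
        -- `Q_d (Q23 E − Q12 D1) ≥ 0`
        have h2 : Q23 * (Q12 * (A1 + A2)) ≤ Q23 * (Qd * E) := mul_le_mul_of_nonneg_left b12' hQ23
        have h3 : Q12 * (Qd * D1) ≤ Q12 * (Q23 * A1) := mul_le_mul_of_nonneg_left a23 hQ12
        have h4 : 0 ≤ Qd * (Q23 * E - Q12 * D1) := by
          have h5 := mul_nonneg hQ23 (mul_nonneg hQ12 nA2)
          ring_nf at h2 h3 h5 ⊢; linarith
        have h5 : 0 ≤ Q23 * E - Q12 * D1 := nonneg_of_mul_pos hQdpos h4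
        have h6 := mul_nonneg hδ h5
        have h7 := mul_nonneg hα (by linarith [b12', mul_nonneg hQ12 nA2] : 0 ≤ Qd * E - Q12 * A1)
        have h8 := mul_nonneg hβ (by linarith [b12'] : 0 ≤ Qd * E - Q12 * (A1 + A2))
        ring_nf at h1 h6 h7 h8 ⊢
        linarith
  -- the `γ`-term
  rcases le_or_gt γ 0 with hγ | hγ
  · have h1 : γ * M13 ≤ 0 := mul_nonpos_of_nonpos_of_nonneg hγ nM13
    linarith
  · rcases hQd.eq_or_lt with hQd0 | hQdpos
    · rcases hdeg hQd0.symm with ⟨-, h13⟩ | ⟨h12, h23⟩ | ⟨h13, -⟩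
      · have zM : M13 = 0 := by linarith
        rw [zM, mul_zero, sub_zero]; exact hX'
      · have hQγ : Q13 * γ ≤ 0 := by
          rw [← hQd0, h12] at H2; linarith
        have hQ130 : Q13 = 0 := le_antisymm (by
          by_contra h; exact absurd hQγ (not_le.2 (mul_pos (lt_of_not_ge h) hγ))) hQ13
        have zM : M13 = 0 := by linarith
        rw [zM, mul_zero, sub_zero]; exact hX'
      · have zM : M13 = 0 := by linarith
        rw [zM, mul_zero, sub_zero]; exact hX'
    · rcases hQ13.eq_or_lt with hQ130 | hQ13pos
      · have zM : M13 = 0 := by linarith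
        rw [zM, mul_zero, sub_zero]; exact hX'
      rcases hQ12.eq_or_lt with hQ120 | hQ12pos
      · -- `[12]` null: the second row gives `Q13 γ ≤ 0`, contradicting `γ > 0`, `Q13 > 0`
        exfalso
        have : Q13 * γ ≤ 0 := by rw [← hQ120] at H2; linarith [mul_nonneg hQd hβ]
        exact absurd this (not_le.2 (mul_pos hQ13pos hγ))
      · -- main: `Q12 Q13 X ≥ 0`
        refine nonneg_of_mul_pos hQ12pos (nonneg_of_mul_pos hQ13pos ?_)
        have Ypos : 0 ≤ Q13 * E - Q12 * M13 := by
          have h1 : Q13 * (Q12 * (A1 + A2)) ≤ Q13 * (Qd * E) := mul_le_mul_of_nonneg_left b12' hQ13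
          have h2 : Q12 * (Qd * M13) ≤ Q12 * (Q13 * A2) := mul_le_mul_of_nonneg_left a13 hQ12
          have h4 : 0 ≤ Qd * (Q13 * E - Q12 * M13) := by
            have h5 := mul_nonneg hQ12 (mul_nonneg hQ13 nA1)
            ring_nf at h1 h2 h5 ⊢; linarith
          exact nonneg_of_mul_pos hQdpos h4
        have hGam : Q12 * (M13 * (Qd * β + Q13 * γ)) ≤ Q12 * (M13 * (Q12 * ε)) :=
          mul_le_mul_of_nonneg_left (mul_le_mul_of_nonneg_left H2 nM13) hQ12
        have hEps : (Q13 * E - Q12 * M13) * (Qd * (α + β) + Q23 * δ) ≤ (Q13 * E - Q12 * M13) * (Q12 * ε) :=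
          mul_le_mul_of_nonneg_left H1 Ypos
        have br_a : 0 ≤ Qd * (Q13 * E - Q12 * M13) - Q12 * Q13 * A1 := by
          have h1 : Q13 * (Q12 * (A1 + A2)) ≤ Q13 * (Qd * E) := mul_le_mul_of_nonneg_left b12' hQ13
          have h2 : Q12 * (Qd * M13) ≤ Q12 * (Q13 * A2) := mul_le_mul_of_nonneg_left a13 hQ12
          ring_nf at h1 h2 ⊢; linarith
        have br_b : 0 ≤ Q13 * (Qd * E - Q12 * (A1 + A2)) := mul_nonneg hQ13 (by linarith [b12'])
        have br_d : 0 ≤ Q23 * (Q13 * E - Q12 * M13) - Q12 * Q13 * D1 := by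
          have h1 : Q23 * (Q13 * (Q12 * (A1 + A2))) ≤ Q23 * (Q13 * (Qd * E)) :=
            mul_le_mul_of_nonneg_left (mul_le_mul_of_nonneg_left b12' hQ13) hQ23
          have h2 : Q23 * (Q12 * (Qd * M13)) ≤ Q23 * (Q12 * (Q13 * A2)) :=
            mul_le_mul_of_nonneg_left (mul_le_mul_of_nonneg_left a13 hQ12) hQ23
          have h3 : Q12 * (Q13 * (Qd * D1)) ≤ Q12 * (Q13 * (Q23 * A1)) :=
            mul_le_mul_of_nonneg_left (mul_le_mul_of_nonneg_left a23 hQ13) hQ12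
          have h4 : 0 ≤ Qd * (Q23 * (Q13 * E - Q12 * M13) - Q12 * Q13 * D1) := by
            ring_nf at h1 h2 h3 ⊢; linarith
          exact nonneg_of_mul_pos hQdpos h4
        have f1 := mul_nonneg hα br_a
        have f2 := mul_nonneg hβ br_b
        have f3 := mul_nonneg hδ br_d
        ring_nf at hGam hEps f1 f2 f3 ⊢
        linarith

end CaseTop

end KNGoodR3

end Summit.CriticalPhenomena.PercolationContinuityZ3.Theorems
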